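import Summits.Ventures.HodgeRepro2.PeterssonFundamentalDomain
import Summits.Ventures.HodgeRepro2.PeterssonSlash

/-!
# The slash action of the normaliser is unitary for the Petersson inner product

Kernel support for the blind cell pub-hodge-repro2 (seat p2), Tier 5 (the Petersson product of N1
§ID-4(b′) as used by the Hecke-side sub-steps).  For `δ ∈ U(H)(K)` normalising `S`
(`δ γ δ⁻¹ ∈ S ⟺ γ ∈ S`):

* the slash operator `f ↦ f ∥_k δ` preserves weight-`k` functions for `S` (`IsWeightFor.slash_of_normalizes`);
* `δ` acts on the ball as a measure-preserving bijection for the Bergman measure, maps fundamental domains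
  of `S` to fundamental domains of `S`, and
* `⟨f ∥_k δ, g ∥_k δ⟩ = ⟨f, g⟩` for the Petersson inner product against `quotientMeasure D`
  (`peterssonInner_slash_slash`): the slash action of the normaliser is UNITARY.

This is the basic input behind the self-adjointness of Hecke operators for the Petersson product.
-/

namespace Summit.Ventures.HodgeRepro2.ShimuraData

open MeasureTheory
open scoped Pointwise

variable {K : Type*} [Field K] [NumberField K] [NumberField.IsCMField K]
    {τ₁ : K →+* ℂ} {H : Matrix (Fin 3) (Fin 3) K} {Q : Matrix (Fin 3) (Fin 3) ℂ}

section Slash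

/-- **The slash operator of a normalising element preserves weight-`k` functions for `S`.** -/
theorem IsWeightFor.slash_of_normalizes (hQ : IsFrame K τ₁ H Q) (S : Subgroup (GL (Fin 3) K))
    (hS : (S : Set (GL (Fin 3) K)) ⊆ unitaryGroup K H) {δ : GL (Fin 3) K} (hδ : δ ∈ unitaryGroup K H)
    (hnorm : ∀ γ : GL (Fin 3) K, γ ∈ S → δ * γ * δ⁻¹ ∈ S) {k : ℕ} {f : (Fin 2 → ℂ) → ℂ}
    (hf : IsWeightFor τ₁ Q S k f) : IsWeightFor τ₁ Q S k (slash k (realEmbedding K τ₁ Q δ) f) := by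
  intro γ hγ z hz
  have hδU : IsInU21 (realEmbedding K τ₁ Q δ) := IsFrame.isInU21_realEmbedding hQ hδ
  have hγU : IsInU21 (realEmbedding K τ₁ Q γ) := IsFrame.isInU21_realEmbedding hQ (hS hγ)
  have hγ'U : IsInU21 (realEmbedding K τ₁ Q (δ * γ * δ⁻¹)) :=
    IsFrame.isInU21_realEmbedding hQ (hS (hnorm γ hγ))
  have hDz : autFactor (realEmbedding K τ₁ Q γ) z ≠ 0 := IsInU21.autFactor_ne_zero hγU hz
  rw [← slash_eq_self_iff hDz]
  -- `(f ∥ δ) ∥ γ = f ∥ (δ γ) = f ∥ ((δ γ δ⁻¹) δ) = (f ∥ (δ γ δ⁻¹)) ∥ δ = f ∥ δ` on the ball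
  have h1 : slash k (realEmbedding K τ₁ Q γ) (slash k (realEmbedding K τ₁ Q δ) f) z =
      slash k (realEmbedding K τ₁ Q (δ * γ)) f z := by
    rw [IsFrame.realEmbedding_mul hQ, slash_mul k hγU f hz]
  have h2 : δ * γ = (δ * γ * δ⁻¹) * δ := by group
  have h3 : slash k (realEmbedding K τ₁ Q ((δ * γ * δ⁻¹) * δ)) f z =
      slash k (realEmbedding K τ₁ Q δ) (slash k (realEmbedding K τ₁ Q (δ * γ * δ⁻¹)) f) z := by
    rw [IsFrame.realEmbedding_mul hQ, slash_mul k hδU f hz]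
  have hz' : ballAction (realEmbedding K τ₁ Q δ) z ∈ ball₂ := hδU.ballAction_mem_ball₂ hz
  have h4 : slash k (realEmbedding K τ₁ Q (δ * γ * δ⁻¹)) f (ballAction (realEmbedding K τ₁ Q δ) z) =
      f (ballAction (realEmbedding K τ₁ Q δ) z) :=
    (slash_eq_self_iff (IsInU21.autFactor_ne_zero hγ'U hz')).mpr (hf _ (hnorm γ hγ) _ hz')
  rw [h1, h2, h3]
  change (autFactor (realEmbedding K τ₁ Q δ) z ^ k)⁻¹ *
      slash k (realEmbedding K τ₁ Q (δ * γ * δ⁻¹)) f (ballAction (realEmbedding K τ₁ Q δ) z) =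
    slash k (realEmbedding K τ₁ Q δ) f z
  rw [h4]
  rfl

end Slash

section Action

variable (hQ : IsFrame K τ₁ H Q)

/-- Continuity of the slash of a continuous function on the ball. -/
theorem continuousOn_slash (k : ℕ) {α : Matrix (Fin 3) (Fin 3) ℂ} (hα : IsInU21 α)
    {f : (Fin 2 → ℂ) → ℂ} (hfc : ContinuousOn f ball₂) : ContinuousOn (slash k α f) ball₂ := by
  unfold slash
  refine ContinuousOn.mul ?_ ?_
  · refine ContinuousOn.inv₀ ((differentiable_autFactor α).continuous.pow k).continuousOn
      fun z hz => pow_ne_zero _ (IsInU21.autFactor_ne_zero hα hz)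
  · refine hfc.comp ?_ fun z hz => hα.ballAction_mem_ball₂ hz
    intro z hz
    exact (hα.differentiableAt_ballAction hz).continuousAt.continuousWithinAt

/-- The action of `δ ∈ U(H)(K)` on the ball (through the frame), as a measurable equivalence of the
subtype `𝔹²`. -/
noncomputable def ballMeasurableEquiv {δ : GL (Fin 3) K} (hδ : δ ∈ unitaryGroup K H) : ball₂ ≃ᵐ ball₂ where
  toFun z := ⟨ballAction (realEmbedding K τ₁ Q δ) z,
    (IsFrame.isInU21_realEmbedding hQ hδ).ballAction_mem_ball₂ z.property⟩
  invFun z := ⟨ballAction (realEmbedding K τ₁ Q δ⁻¹) z,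
    (IsFrame.isInU21_realEmbedding hQ (inv_mem hδ)).ballAction_mem_ball₂ z.property⟩
  left_inv z := Subtype.ext (by
    simp only
    rw [IsFrame.realEmbedding_inv hQ]
    exact (IsFrame.isInU21_realEmbedding hQ hδ).ballAction_inv_ballAction z.property)
  right_inv z := Subtype.ext (by
    simp only
    rw [IsFrame.realEmbedding_inv hQ]
    exact (IsFrame.isInU21_realEmbedding hQ hδ).ballAction_ballAction_inv z.property)
  measurable_toFun := ((measurable_ballAction _).comp measurable_subtype_coe).subtype_mk
  measurable_invFun := ((measurable_ballAction _).comp measurable_subtype_coe).subtype_mk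

/-- The underlying point map of `ballMeasurableEquiv`. -/
theorem coe_ballMeasurableEquiv_apply {δ : GL (Fin 3) K} (hδ : δ ∈ unitaryGroup K H) (z : ball₂) :
    (ballMeasurableEquiv hQ hδ z : Fin 2 → ℂ) = ballAction (realEmbedding K τ₁ Q δ) z := rfl

/-- The inverse equivalence is the equivalence of `δ⁻¹`. -/
theorem ballMeasurableEquiv_symm_apply {δ : GL (Fin 3) K} (hδ : δ ∈ unitaryGroup K H) (z : ball₂) :
    (ballMeasurableEquiv hQ hδ).symm z = ballMeasurableEquiv hQ (inv_mem hδ) z := rfl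

/-- **`δ` preserves the Bergman measure on `𝔹²`** (preimage form). -/
theorem bergmanBall_preimage_ballMeasurableEquiv {δ : GL (Fin 3) K} (hδ : δ ∈ unitaryGroup K H)
    {A : Set ball₂} (hA : MeasurableSet A) :
    bergmanBall (ballMeasurableEquiv hQ hδ ⁻¹' A) = bergmanBall A := by
  have hg : IsInU21 (realEmbedding K τ₁ Q δ) := IsFrame.isInU21_realEmbedding hQ hδ
  have hAm : MeasurableSet (Subtype.val '' A) :=
    (MeasurableEmbedding.subtype_coe measurableSet_ball₂).measurableSet_image.mpr hA
  rw [bergmanBall_apply, bergmanBall_apply]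
  have himg : Subtype.val '' (ballMeasurableEquiv hQ hδ ⁻¹' A) =
      (ballAction (realEmbedding K τ₁ Q δ)) ⁻¹' (Subtype.val '' A) ∩ ball₂ := by
    ext w
    constructor
    · rintro ⟨z, hz, rfl⟩
      exact ⟨⟨ballMeasurableEquiv hQ hδ z, hz, rfl⟩, z.property⟩
    · rintro ⟨⟨u, hu, huw⟩, hw⟩
      refine ⟨⟨w, hw⟩, ?_, rfl⟩
      show ballMeasurableEquiv hQ hδ ⟨w, hw⟩ ∈ A
      have : ballMeasurableEquiv hQ hδ ⟨w, hw⟩ = u := Subtype.ext huw.symm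
      rw [this]
      exact hu
  rw [himg, bergmanMeasure_inter_ball₂ ((measurable_ballAction _) hAm),
    ← Measure.map_apply (measurable_ballAction _) hAm, map_ballAction_bergmanMeasure hg]

/-- **`δ` preserves the Bergman measure on `𝔹²`.** -/
theorem measurePreserving_ballMeasurableEquiv {δ : GL (Fin 3) K} (hδ : δ ∈ unitaryGroup K H) :
    MeasurePreserving (ballMeasurableEquiv hQ hδ) bergmanBall bergmanBall :=
  ⟨(ballMeasurableEquiv hQ hδ).measurable, Measure.ext fun A hA => by
    rw [Measure.map_apply (ballMeasurableEquiv hQ hδ).measurable hA,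
      bergmanBall_preimage_ballMeasurableEquiv hQ hδ hA]⟩

/-- Change of variables `z ↦ δz` for set integrals against the Bergman measure on `𝔹²`. -/
theorem setIntegral_ballMeasurableEquiv {δ : GL (Fin 3) K} (hδ : δ ∈ unitaryGroup K H)
    {F : Type*} [NormedAddCommGroup F] [NormedSpace ℝ F] (g : ball₂ → F) (D : Set ball₂) :
    ∫ z in D, g (ballMeasurableEquiv hQ hδ z) ∂bergmanBall =
      ∫ w in ballMeasurableEquiv hQ hδ '' D, g w ∂bergmanBall := by
  conv_lhs => rw [← (ballMeasurableEquiv hQ hδ).toEquiv.preimage_image D, MeasurableEquiv.coe_toEquiv]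
  exact (measurePreserving_ballMeasurableEquiv hQ hδ).setIntegral_preimage_emb
    (ballMeasurableEquiv hQ hδ).measurableEmbedding g _

end Action

section FundamentalDomain

variable (hQ : IsFrame K τ₁ H Q) (S : Subgroup (GL (Fin 3) K))
    (hS : (S : Set (GL (Fin 3) K)) ⊆ unitaryGroup K H)

/-- Conjugation by `δ⁻¹` as an equivalence of the normalised subgroup `S`. -/
def conjEquiv {δ : GL (Fin 3) K} (hnorm : ∀ γ : GL (Fin 3) K, δ * γ * δ⁻¹ ∈ S ↔ γ ∈ S) : S ≃ S where
  toFun g := ⟨δ⁻¹ * g * δ, (hnorm _).mp (by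
    have : δ * (δ⁻¹ * (g : GL (Fin 3) K) * δ) * δ⁻¹ = g := by group
    rw [this]
    exact g.property)⟩
  invFun g := ⟨δ * g * δ⁻¹, (hnorm _).mpr g.property⟩
  left_inv g := Subtype.ext (by simp only; group)
  right_inv g := Subtype.ext (by simp only; group)

/-- **The image of a fundamental domain under a normalising `δ` is a fundamental domain.** -/
theorem isBallFundamentalDomain_image {δ : GL (Fin 3) K} (hδ : δ ∈ unitaryGroup K H)
    (hnorm : ∀ γ : GL (Fin 3) K, δ * γ * δ⁻¹ ∈ S ↔ γ ∈ S) {D : Set ball₂}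
    (hD : IsBallFundamentalDomain hQ S hS D) :
    IsBallFundamentalDomain hQ S hS (ballMeasurableEquiv hQ hδ '' D) := by
  letI := frameAction hQ S hS
  refine hD.image_of_equiv (ballMeasurableEquiv hQ hδ).toEquiv ?_ (conjEquiv S hnorm) ?_
  · exact (measurePreserving_ballMeasurableEquiv hQ (inv_mem hδ)).quasiMeasurePreserving
  · intro g x
    apply Subtype.ext
    simp only [MeasurableEquiv.coe_toEquiv, coe_ballMeasurableEquiv_apply,
      frameAction_smul_coe, conjEquiv, Equiv.coe_fn_mk]
    have hg' : IsInU21 (realEmbedding K τ₁ Q (δ⁻¹ * g * δ)) :=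
      IsFrame.isInU21_realEmbedding hQ (hS ((conjEquiv S hnorm g).property))
    have hδ' : IsInU21 (realEmbedding K τ₁ Q δ) := IsFrame.isInU21_realEmbedding hQ hδ
    rw [← IsInU21.ballAction_mul hg' x.property, ← IsInU21.ballAction_mul hδ' x.property,
      ← IsFrame.realEmbedding_mul hQ, ← IsFrame.realEmbedding_mul hQ]
    congr 2
    group

end FundamentalDomain

section Unitary

variable (hQ : IsFrame K τ₁ H Q) (S : Subgroup (GL (Fin 3) K))
    (hS : (S : Set (GL (Fin 3) K)) ⊆ unitaryGroup K H)

/-- **Unitarity of the slash action of the normaliser for the Petersson inner product**: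
`⟨f ∥_k δ, g ∥_k δ⟩ = ⟨f, g⟩` against `quotientMeasure D` for every measurable fundamental domain `D`. -/
theorem peterssonInner_slash_slash {δ : GL (Fin 3) K} (hδ : δ ∈ unitaryGroup K H)
    (hnorm : ∀ γ : GL (Fin 3) K, δ * γ * δ⁻¹ ∈ S ↔ γ ∈ S) {D : Set ball₂} (hDm : MeasurableSet D)
    (hD : IsBallFundamentalDomain hQ S hS D) {k : ℕ} {f g : (Fin 2 → ℂ) → ℂ}
    (hf : IsWeightFor τ₁ Q S k f) (hg : IsWeightFor τ₁ Q S k g) (hfc : ContinuousOn f ball₂)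
    (hgc : ContinuousOn g ball₂) :
    peterssonInner hQ S hS (quotientMeasure hQ S hS D)
        (hf.slash_of_normalizes hQ S hS hδ fun γ hγ => (hnorm γ).mpr hγ)
        (hg.slash_of_normalizes hQ S hS hδ fun γ hγ => (hnorm γ).mpr hγ) =
      peterssonInner hQ S hS (quotientMeasure hQ S hS D) hf hg := by
  have hδU : IsInU21 (realEmbedding K τ₁ Q δ) := IsFrame.isInU21_realEmbedding hQ hδ
  rw [peterssonInner_quotientMeasure hQ S hS D _ _ (continuousOn_slash k hδU hfc)
    (continuousOn_slash k hδU hgc), peterssonInner_quotientMeasure hQ S hS D hf hg hfc hgc]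
  calc ∫ z in D, peterssonPair k (slash k (realEmbedding K τ₁ Q δ) f)
        (slash k (realEmbedding K τ₁ Q δ) g) (z : Fin 2 → ℂ) ∂bergmanBall
      = ∫ z in D, peterssonPair k f g ((ballMeasurableEquiv hQ hδ z : ball₂) : Fin 2 → ℂ) ∂bergmanBall :=
        setIntegral_congr_fun hDm fun z _ => by
          rw [coe_ballMeasurableEquiv_apply]
          exact peterssonPair_slash k hδU f g z.property
    _ = ∫ w in ballMeasurableEquiv hQ hδ '' D, peterssonPair k f g (w : Fin 2 → ℂ) ∂bergmanBall :=
        setIntegral_ballMeasurableEquiv hQ hδ (fun w : ball₂ => peterssonPair k f g (w : Fin 2 → ℂ)) D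
    _ = ∫ z in D, peterssonPair k f g (z : Fin 2 → ℂ) ∂bergmanBall :=
        setIntegral_peterssonPair_eq hQ S hS (isBallFundamentalDomain_image hQ S hS hδ hnorm hD) hD hf hg

end Unitary

end Summit.Ventures.HodgeRepro2.ShimuraData
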